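import Summits.QuantumFields.YangMills.Theorems.BalabanUVNodesN15CovariantLandauNeumannRowsII
import Summits.QuantumFields.YangMills.Theorems.BalabanUVNodesN15CovariantAveragingTransportSizes
import HarnessLib

/-!
# Route «BalabanUVNodes», node N15 = NE2, road (c) — PROGRAMME (P-S), VI: THE GLOBAL ROW OF THE LANDAU PERTURBATION LETTER FROM THE FLAT PROPAGATOR ROWS, THE ONE COVARIANT GRADIENT
# DIFFERENCE AND THE TRANSPORTER LETTERS — per grid, with a constant LINEAR in the field size `r` and an explicit smallness threshold (dag-n15-c g23, n15-c∕217)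

Cell `pub-ymgap`, seat `pub-ymgap-dag-n15-c` (generation g23; R134 (a), s1; HUMAN RULING D-0062; chair R424 venue).  `bears_on: R4∕N15 · K3⁸ SpineGivenEndpointR13SepCoPHV
(stmt-QuantumFields-27366)`; filed `--supports stmt-QuantumFields-27366 --as helper` — COUNT-NEUTRAL.  Bookkeeping `def`s of explicit constants (`cA0`, `cK1`, `cPG0`, `cM2`, `cB0`,
`landauSmallConst`, `landauRowConst`) + theorems; 0 `sorry`; NO estimate of Bałaban's.  Imports BY NAME n15-c∕216 (`hasMaj_cGreen_sub_of_flat`, `hasMaj_cSop_inv_of_flat`), through it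
n15-c∕215 (`hasMaj_cGreen_of_flat`), n15-c∕214 (`hasMaj_landauCov_sub`, `hasMaj_cM_of`, `hasMaj_cM_sub_of`, `hasMaj_cSop_sub_of`, `landauLetterConst`), n15-c∕182a
(`CovAvg.rows_le_of_rows_sub_one`, `cols_le_of_cols_sub_one`), `B11SectG.HasMaj.of_rate_le∕mono`.  Nothing in the tree is modified.

WHY.  n15-c∕214 reduces the global row of `N_V^R` to nine primitive rows; n15-c∕215–216 derive the three covariant ones that are not Schauder-type from the flat rows.  THIS FILE chains
them: GIVEN the four FLAT rows `G′(1) ≤ C_Ge^{−δd}`, `G′(1)∂ᵀ ≤ C_Ae^{−δd}`, `∂G′(1) ≤ C_De^{−δd}`, `(Q′G′²Q′ᵀ)⁻¹(1) ≤ C_Sn^{d+1}e^{−δd}` ([Balaban1984PropagatorsII] Props. 2.2–2.3 =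
[Balaban1985BackgroundPropagators] Thms 3.1–3.2 at `U ≡ 1`), the ONE covariant gradient difference `D_TG′(T) − ∂G′(1) ≤ P₀·r·e^{−δd}` (Thm 3.4) and transporter letters `nρ ≤ C_ρr`,
`σ ≤ C_σr` (n15-c∕205; at the node `r = r_A = c₃₅L^mα₀` by (3.35)), for `r ≤ 1` below the explicit threshold `landauSmallConst·r ≤ 1`, the matrix of `N_V^R` has the block row
`landauRowConst·r·e^{−(3δ/8)d}` — LINEAR in `r`, constants depending on `d, |ι|, δ, C_G, C_A, C_D, C_S, P₀, C_ρ, C_σ` and the mass ratio `α ≥ |a|n^{−(d+1)}` only (n15-c∕211's `hG1`∕`hG2`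
shape with `c_R = landauRowConst`).
* §1 `landauLetterConst_mono`, `landauLetterConst_linear`; the explicit constants.
* §2 ★★★ **`hasMaj_landauCov_sub_of_flat`**.

HONEST FRAMING ∕ LIMITS.  Bookkeeping; the four flat rows and the gradient difference are HYPOTHESES; MODEL READING as n15-c∕197; NOT [Balaban1985BackgroundPropagators] Thms 3.1–3.4 as
printed; NE2⁺ NOT PRINTED; N15 of record untouched (DISCHARGED AS CONSUMED, p687738); counts UNMOVED (typed 28∕28 · discharged 8∕27); one finite 𝕋⁴ at fixed ε per index — NOT infinite
volume ∕ OS ∕ mass gap ∕ Clay.  Restate-immune (no Theses import).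
-/

noncomputable section

open scoped BigOperators Matrix
open Finset

namespace Summit.QuantumFields.YangMills.BalabanUVNodes.N15.CovLandau

open Literature.MathematicalPhysics.QuantumFieldTheory.Balaban1983to89
open Literature.MathematicalPhysics.QuantumFieldTheory.Balaban1983to89.B5Prop11Plancherel (Tor fine)
open Literature.MathematicalPhysics.QuantumFieldTheory.Balaban1983to89.B11SectG (BlockNorm HasMaj RowSum)
open Literature.MathematicalPhysics.QuantumFieldTheory.Balaban1983to89.B6UnitTorusCarrier (unitTorusGeo rowSum_unitTorusGeo unitTorusGeo_dist_nonneg)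
open Literature.MathematicalPhysics.QuantumFieldTheory.King1986.Torus (blockOf tdistT)
open Summit.QuantumFields.YangMills.BalabanUVNodes.N15.MatrixSpecies (liftBlk)
open Summit.QuantumFields.YangMills.BalabanUVNodes.N15.CovAvg (cvaStair cvaStair_one rows_le_of_rows_sub_one cols_le_of_cols_sub_one)

variable {d : ℕ}

/-! ## §1 The explicit constants; monotonicity and linearity of `landauLetterConst` -/

section Consts

omit d in
/-- `landauLetterConst` is monotone in its four "small" slots `P_D, P_G, τ, σ`. [folklore] -/
theorem landauLetterConst_mono {D I cs CS CG CD PD PG τ σ PD' PG' τ' σ' : ℝ} (hD : 0 ≤ D) (hI : 0 ≤ I) (hcs : 0 ≤ cs) (hCS : 0 ≤ CS) (hCG : 0 ≤ CG) (hCD : 0 ≤ CD)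
    (hPD : 0 ≤ PD) (hPG : 0 ≤ PG) (hτ : 0 ≤ τ) (hσ : 0 ≤ σ) (h1 : PD ≤ PD') (h2 : PG ≤ PG') (h3 : τ ≤ τ') (h4 : σ ≤ σ') :
    landauLetterConst D I cs CS CG CD PD PG τ σ ≤ landauLetterConst D I cs CS CG CD PD' PG' τ' σ' := by
  have hPD' : 0 ≤ PD' := hPD.trans h1
  have hPG' : 0 ≤ PG' := hPG.trans h2
  have hτ' : 0 ≤ τ' := hτ.trans h3
  have hσ' : 0 ≤ σ' := hσ.trans h4
  unfold landauLetterConst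
  gcongr

omit d in
/-- `landauLetterConst` is LINEAR in a common factor `r ≤ 1` of its small slots `P_D, P_G, σ`: every monomial carries one of them. [folklore] -/
theorem landauLetterConst_linear {D I cs CS CG CD P Q τ S r : ℝ} (hD : 0 ≤ D) (hI : 0 ≤ I) (hcs : 0 ≤ cs) (hCS : 0 ≤ CS) (hCG : 0 ≤ CG) (hCD : 0 ≤ CD) (hP : 0 ≤ P) (hQ : 0 ≤ Q)
    (hτ : 0 ≤ τ) (hS : 0 ≤ S) (hr0 : 0 ≤ r) (hr1 : r ≤ 1) :
    landauLetterConst D I cs CS CG CD (P * r) (Q * r) τ (S * r) ≤ r * landauLetterConst D I cs CS CG CD P Q τ S := by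
  have hPr : CD + P * r ≤ CD + P := add_le_add le_rfl (mul_le_of_le_one_right hP hr1)
  have heq : landauLetterConst D I cs CS CG CD (P * r) (Q * r) τ (S * r) =
      r * (D * I ^ 3 * cs ^ 2 * CS * ((P * τ + CD * S) * ((CD + P * r) * τ) + CD * (P * τ + CD * S) + I * cs ^ 3 * CS * CG * (τ + 1) * CD * ((CD + P * r) * τ) * (Q * τ + CG * S))) := by
    unfold landauLetterConst; ring
  rw [heq]
  refine mul_le_mul_of_nonneg_left ?_ hr0
  unfold landauLetterConst
  gcongr

/-- `A₀ = C_G + C_G(d+1)C_ρe^{δ}(C_D + P₀)c²` — the bound of the source constant of n15-c∕215 (`r ≤ 1`). [folklore] -/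
def cA0 (D cG cD P0 Cρ c δ : ℝ) : ℝ := cG + cG * (D * Cρ) * Real.exp δ * (cD + P0) * c * c

/-- `K₁ = C_AC_ρe^{δ}c + 3αC_GC_σ` — `θ_K ≤ K₁·r` for the small operator of n15-c∕215. [folklore] -/
def cK1 (cG cA Cρ Cσ α c δ : ℝ) : ℝ := cA * Cρ * Real.exp δ * c + α * (cG * (3 * Cσ))

/-- `PG₀` — `P_G ≤ PG₀·r` for the `G′(T) − G′(1)` constant of n15-c∕216 (with `C_T = 2A₀`). [folklore] -/
def cPG0 (D cG cA cD P0 Cρ Cσ α c δ : ℝ) : ℝ :=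
  cG * (D * Cρ * Real.exp δ) * c * (cD + P0) * c + cA * (Cρ * Real.exp δ * (2 * cA0 D cG cD P0 Cρ c δ) * c) * c +
    α * (cG * (Cσ * (2 * (2 * cA0 D cG cD P0 Cρ c δ))) * c) + α * (cG * (Cσ * (2 * cA0 D cG cD P0 Cρ c δ)) * c)

/-- `C_M = 2A₀ + C_G` — a common constant for the rows of `G′(T)` and `G′(1)`. [folklore] -/
def cM2 (D cG cD P0 Cρ c δ : ℝ) : ℝ := 2 * cA0 D cG cD P0 Cρ c δ + cG

/-- `B₀` — `B ≤ B₀·r` for the `S(T) − S(1)` constant of n15-c∕214. [folklore] -/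
def cB0 (D I cG cA cD P0 Cρ Cσ α c δ : ℝ) : ℝ := I * c * cM2 D cG cD P0 Cρ c δ * 3 * (2 * cPG0 D cG cA cD P0 Cρ Cσ α c δ + cM2 D cG cD P0 Cρ c δ * Cσ)

/-- THE SMALLNESS CONSTANT: `landauSmallConst·r ≤ 1` makes both Neumann series converge with ratio `≤ ½` and the transporter letters `≤ ½`. [folklore] -/
def landauSmallConst (D I cG cA cD cS P0 Cρ Cσ α c δ : ℝ) : ℝ :=
  2 * (cK1 cG cA Cρ Cσ α c δ * c + cS * cB0 D I cG cA cD P0 Cρ Cσ α c δ * c * c) + Cρ + Cσ + 1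

/-- THE ROW CONSTANT `c_R` of the Landau letter per unit field size. [folklore] -/
def landauRowConst (D I cG cA cD cS P0 Cρ Cσ α c c' δ : ℝ) : ℝ :=
  landauLetterConst D I c' (2 * cS) (cM2 D cG cD P0 Cρ c δ) cD P0 (cPG0 D cG cA cD P0 Cρ Cσ α c δ) 2 Cσ

end Consts

/-! ## §2 The global row from the flat rows -/

section Main

variable (M : Fin (d + 1) → ℕ) [∀ μ, NeZero (M μ)] (n : ℕ) [NeZero n] {ι : Type} [Fintype ι] [DecidableEq ι] (L k : ℕ)

set_option maxHeartbeats 1000000 in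
/-- ★★★ **THE GLOBAL ROW OF `N_V^R` FROM THE FLAT PROPAGATOR ROWS, THE ONE COVARIANT GRADIENT DIFFERENCE AND THE TRANSPORTER LETTERS.**  Fine torus `Tor (fine n M)`, King unit blocks,
invertible datum `T`, `a > 0` with `|a|n^{−(d+1)} ≤ α`; rate `δ > 0`, margin `s = δ/16`, `c = c_{d+1}(s)`; FLAT rows `G′(1) ≤ C_Ge^{−δd}`, `G′(1)∂ᵀ ≤ C_Ae^{−δd}`, `∂G′(1) ≤ C_De^{−δd}`,
`(Q′G′²Q′ᵀ)⁻¹(1) ≤ C_Sn^{d+1}e^{−δd}`; covariant gradient difference `D_TG′(T) − ∂G′(1) ≤ P₀re^{−δd}`; letters `nρ ≤ C_ρr`, `σ ≤ C_σr` (entry rows∕cols of `T − 1`, staircase differences);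
`0 ≤ r ≤ 1` with `landauSmallConst·r ≤ 1`.  THEN `landauCov T a − landauCov 1 a ≤ landauRowConst·r·e^{−(3δ/8)d}` on coloured fine 1-forms.
[cite: Balaban1985BackgroundPropagators, (3.49) p.399, Thm 3.1 (3.42) p.397, Thm 3.2 (3.48) p.398, Thm 3.4 p.400; Balaban1984PropagatorsII, (2.52)–(2.56) pp.232–233, Lemma 2.1 (2.61) p.234] -/
theorem hasMaj_landauCov_sub_of_flat {T : Fin (d + 1) → Tor (fine n M) → Matrix ι ι ℝ} (hT : ∀ ν x, IsUnit (T ν x)) {a : ℝ} (ha : 0 < a)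
    {δ CG CA CD CS P0 Cρ Cσ α r ρ σ : ℝ} (hδ : 0 < δ) (hCG : 0 ≤ CG) (hCA : 0 ≤ CA) (hCD : 0 ≤ CD) (hCS : 0 ≤ CS) (hP0 : 0 ≤ P0) (hCρ : 0 ≤ Cρ) (hCσ : 0 ≤ Cσ) (hα : 0 ≤ α)
    (hr0 : 0 ≤ r) (hr1 : r ≤ 1) (hρ0 : 0 ≤ ρ) (hσ0 : 0 ≤ σ) (haα : |a| * ((n : ℝ) ^ (d + 1))⁻¹ ≤ α)
    (hρr : ∀ ν x i, ∑ j, |(T ν x - (fun (_ : Fin (d + 1)) (_ : Tor (fine n M)) => (1 : Matrix ι ι ℝ)) ν x) i j| ≤ ρ)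
    (hρc : ∀ ν x j, ∑ i, |(T ν x - (fun (_ : Fin (d + 1)) (_ : Tor (fine n M)) => (1 : Matrix ι ι ℝ)) ν x) i j| ≤ ρ)
    (hσr : ∀ y a' i, ∑ j, |(cvaStair M n (fun μ b => T μ b.1) y a' 0 - cvaStair M n (fun μ b => (fun (_ : Fin (d + 1)) (_ : Tor (fine n M)) => (1 : Matrix ι ι ℝ)) μ b.1) y a' 0) i j| ≤ σ)
    (hσc : ∀ y a' j, ∑ i, |(cvaStair M n (fun μ b => T μ b.1) y a' 0 - cvaStair M n (fun μ b => (fun (_ : Fin (d + 1)) (_ : Tor (fine n M)) => (1 : Matrix ι ι ℝ)) μ b.1) y a' 0) i j| ≤ σ)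
    (hnρ : (n : ℝ) * ρ ≤ Cρ * r) (hσle : σ ≤ Cσ * r)
    (hG1 : HasMaj (BlockNorm.ofBlocks (unitTorusGeo L k M) (liftBlk (blockOf n M) ι)) (BlockNorm.ofBlocks (unitTorusGeo L k M) (liftBlk (blockOf n M) ι)) (Matrix.mulVecLin (cGreen M n (fun (_ : Fin (d + 1)) (_ : Tor (fine n M)) => (1 : Matrix ι ι ℝ)) a)) (fun y y' => CG * Real.exp (-(δ * tdistT M y y'))))
    (hA1 : HasMaj (BlockNorm.ofBlocks (unitTorusGeo L k M) (liftBlk (fun b : Tor (fine n M) × Fin (d + 1) => blockOf n M b.1) ι)) (BlockNorm.ofBlocks (unitTorusGeo L k M) (liftBlk (blockOf n M) ι)) (Matrix.mulVecLin (cGreen M n (fun (_ : Fin (d + 1)) (_ : Tor (fine n M)) => (1 : Matrix ι ι ℝ)) a * (cgrad M n (fun (_ : Fin (d + 1)) (_ : Tor (fine n M)) => (1 : Matrix ι ι ℝ)))ᵀ)) (fun y y' => CA * Real.exp (-(δ * tdistT M y y'))))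
    (hD1 : HasMaj (BlockNorm.ofBlocks (unitTorusGeo L k M) (liftBlk (blockOf n M) ι)) (BlockNorm.ofBlocks (unitTorusGeo L k M) (liftBlk (fun b : Tor (fine n M) × Fin (d + 1) => blockOf n M b.1) ι)) (Matrix.mulVecLin (cgrad M n (fun (_ : Fin (d + 1)) (_ : Tor (fine n M)) => (1 : Matrix ι ι ℝ)) * cGreen M n (fun (_ : Fin (d + 1)) (_ : Tor (fine n M)) => (1 : Matrix ι ι ℝ)) a)) (fun y y' => CD * Real.exp (-(δ * tdistT M y y'))))
    (hS1 : HasMaj (BlockNorm.ofBlocks (unitTorusGeo L k M) (liftBlk (fun y : Tor M => y) ι)) (BlockNorm.ofBlocks (unitTorusGeo L k M) (liftBlk (fun y : Tor M => y) ι)) (Matrix.mulVecLin (cSop M n (fun (_ : Fin (d + 1)) (_ : Tor (fine n M)) => (1 : Matrix ι ι ℝ)) a)⁻¹) (fun y y' => CS * (n : ℝ) ^ (d + 1) * Real.exp (-(δ * tdistT M y y'))))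
    (hδD : HasMaj (BlockNorm.ofBlocks (unitTorusGeo L k M) (liftBlk (blockOf n M) ι)) (BlockNorm.ofBlocks (unitTorusGeo L k M) (liftBlk (fun b : Tor (fine n M) × Fin (d + 1) => blockOf n M b.1) ι)) (Matrix.mulVecLin (cgrad M n T * cGreen M n T a - cgrad M n (fun (_ : Fin (d + 1)) (_ : Tor (fine n M)) => (1 : Matrix ι ι ℝ)) * cGreen M n (fun (_ : Fin (d + 1)) (_ : Tor (fine n M)) => (1 : Matrix ι ι ℝ)) a)) (fun y y' => P0 * r * Real.exp (-(δ * tdistT M y y'))))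
    (hsmall : landauSmallConst (d + 1) (Fintype.card ι) CG CA CD CS P0 Cρ Cσ α (B4Sect5Proof.latticeConst (d + 1) (δ / 16)) δ * r ≤ 1) :
    HasMaj (BlockNorm.ofBlocks (unitTorusGeo L k M) (liftBlk (fun b : Tor (fine n M) × Fin (d + 1) => blockOf n M b.1) ι)) (BlockNorm.ofBlocks (unitTorusGeo L k M) (liftBlk (fun b : Tor (fine n M) × Fin (d + 1) => blockOf n M b.1) ι)) (Matrix.mulVecLin (landauCov M n T a - landauCov M n (fun (_ : Fin (d + 1)) (_ : Tor (fine n M)) => (1 : Matrix ι ι ℝ)) a))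
      (fun y y' => landauRowConst (d + 1) (Fintype.card ι) CG CA CD CS P0 Cρ Cσ α (B4Sect5Proof.latticeConst (d + 1) (δ / 16)) (B4Sect5Proof.latticeConst (d + 1) (3 * δ / 4 / 8)) δ * r *
        Real.exp (-((3 * δ / 8) * tdistT M y y'))) := by
  -- constants (opaque names with defining equations; rate facts first, while the context is small)
  have hn : (0 : ℝ) < (n : ℝ) ^ (d + 1) := pow_pos (Nat.cast_pos.mpr (Nat.pos_of_ne_zero (NeZero.ne n))) _
  have hd := unitTorusGeo_dist_nonneg L k M
  set s : ℝ := δ / 16 with hsdef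
  have hs : 0 < s := by positivity
  have hr2s : 2 * s ≤ δ := by linarith
  have hr3 : s ≤ δ - 2 * s := by linarith
  have hr4 : δ - 2 * s ≤ δ := by linarith
  have hr5 : δ - 2 * s + 2 * s ≤ δ := by linarith
  have hr6 : 0 ≤ δ - 2 * s := by linarith
  have hr7 : δ - 2 * s + s ≤ δ := by linarith
  have hr8 : 3 * δ / 4 ≤ δ - 2 * s - 2 * s := by linarith
  have hr9 : 3 * δ / 4 ≤ δ := by linarith
  have hr10 : 3 * δ / 4 ≤ δ - 2 * s := by linarith
  have hr11 : 3 * δ / 8 ≤ 3 * δ / 4 / 2 := by linarith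
  have hr12 : 0 < 3 * δ / 4 := by positivity
  have hr13 : 2 * s ≤ δ - 2 * s := by linarith
  set c : ℝ := B4Sect5Proof.latticeConst (d + 1) s with hcdef
  have hrow : RowSum (unitTorusGeo L k M) s c := rowSum_unitTorusGeo L k M hs
  have hc : 0 ≤ c := B4Sect5Proof.latticeConst_nonneg (d + 1) hs.le
  have hD : (0 : ℝ) ≤ ((d : ℝ) + 1) := by positivity
  have hI : (0 : ℝ) ≤ (Fintype.card ι : ℝ) := Nat.cast_nonneg _
  obtain ⟨A0, hA0def⟩ : ∃ x : ℝ, x = cA0 ((d : ℝ) + 1) CG CD P0 Cρ c δ := ⟨_, rfl⟩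
  have hA0 : 0 ≤ A0 := by rw [hA0def]; unfold cA0; positivity
  obtain ⟨K1, hK1def⟩ : ∃ x : ℝ, x = cK1 CG CA Cρ Cσ α c δ := ⟨_, rfl⟩
  have hK1 : 0 ≤ K1 := by rw [hK1def]; unfold cK1; positivity
  obtain ⟨PG0, hPG0def⟩ : ∃ x : ℝ, x = cPG0 ((d : ℝ) + 1) CG CA CD P0 Cρ Cσ α c δ := ⟨_, rfl⟩
  have hPG0 : 0 ≤ PG0 := by rw [hPG0def]; unfold cPG0 cA0; positivity
  obtain ⟨CM, hCMdef⟩ : ∃ x : ℝ, x = cM2 ((d : ℝ) + 1) CG CD P0 Cρ c δ := ⟨_, rfl⟩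
  have hCM : CM = 2 * A0 + CG := by rw [hCMdef, hA0def]; rfl
  have hCM0 : 0 ≤ CM := by rw [hCM]; positivity
  obtain ⟨B0, hB0def⟩ : ∃ x : ℝ, x = cB0 ((d : ℝ) + 1) (Fintype.card ι : ℝ) CG CA CD P0 Cρ Cσ α c δ := ⟨_, rfl⟩
  have hB0eq : B0 = (Fintype.card ι : ℝ) * c * CM * 3 * (2 * PG0 + CM * Cσ) := by rw [hB0def, hCMdef, hPG0def]; rfl
  have hB0 : 0 ≤ B0 := by rw [hB0eq]; positivity
  -- the smallness consequences
  have hsm : landauSmallConst ((d : ℝ) + 1) (Fintype.card ι : ℝ) CG CA CD CS P0 Cρ Cσ α c δ = 2 * (K1 * c + CS * B0 * c * c) + Cρ + Cσ + 1 := by rw [hK1def, hB0def]; rfl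
  have hsmall' : (2 * (K1 * c + CS * B0 * c * c) + Cρ + Cσ + 1) * r ≤ 1 := by rw [← hsm]; exact hsmall
  have hKc0 : 0 ≤ K1 * c := mul_nonneg hK1 hc
  have hSB0 : 0 ≤ CS * B0 * c * c := by positivity
  have hsum0 : 0 ≤ 2 * (K1 * c + CS * B0 * c * c) + Cρ + Cσ + 1 := by positivity
  have hle1 : Cσ * r ≤ 1 :=
    (mul_le_mul_of_nonneg_right (by linarith only [hKc0, hSB0, hCρ] : Cσ ≤ 2 * (K1 * c + CS * B0 * c * c) + Cρ + Cσ + 1) hr0).trans hsmall'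
  have hle2 : Cρ * r ≤ 1 :=
    (mul_le_mul_of_nonneg_right (by linarith only [hKc0, hSB0, hCσ] : Cρ ≤ 2 * (K1 * c + CS * B0 * c * c) + Cρ + Cσ + 1) hr0).trans hsmall'
  have hle3 : (2 * (K1 * c)) * r ≤ 1 :=
    (mul_le_mul_of_nonneg_right (by linarith only [hSB0, hCσ, hCρ] : 2 * (K1 * c) ≤ 2 * (K1 * c + CS * B0 * c * c) + Cρ + Cσ + 1) hr0).trans hsmall'
  have hle4 : (2 * (CS * B0 * c * c)) * r ≤ 1 :=
    (mul_le_mul_of_nonneg_right (by linarith only [hKc0, hCσ, hCρ] : 2 * (CS * B0 * c * c) ≤ 2 * (K1 * c + CS * B0 * c * c) + Cρ + Cσ + 1) hr0).trans hsmall'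
  have hσ1 : σ ≤ 1 := hσle.trans hle1
  have hnρ1 : (n : ℝ) * ρ ≤ 1 := hnρ.trans hle2
  have hq1 : K1 * c * r ≤ 1 / 2 := by linarith only [hle3]
  have hq2 : CS * B0 * c * c * r ≤ 1 / 2 := by linarith only [hle4]
  -- the staircase sums `τ := 1 + σ ≤ 2`
  have e1 : ∀ (y : Tor M) (a' : Fin (d + 1) → Fin n), cvaStair M n (fun μ (b : Tor (fine n M) × Fin (d + 1)) => (fun (_ : Fin (d + 1)) (_ : Tor (fine n M)) => (1 : Matrix ι ι ℝ)) μ b.1) y a' 0 = 1 := fun y a' => cvaStair_one M n y a' 0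
  have hτr : ∀ y a' i, ∑ j, |cvaStair M n (fun μ b => T μ b.1) y a' 0 i j| ≤ 1 + σ := fun y a' i =>
    rows_le_of_rows_sub_one (A := cvaStair M n (fun μ b => T μ b.1) y a' 0) (fun i' => by have h := hσr y a' i'; rwa [e1] at h) i
  have hτc : ∀ y a' i, ∑ j, |cvaStair M n (fun μ b => T μ b.1) y a' 0 j i| ≤ 1 + σ := fun y a' i =>
    cols_le_of_cols_sub_one (A := cvaStair M n (fun μ b => T μ b.1) y a' 0) (fun j' => by have h := hσc y a' j'; rwa [e1] at h) i
  have hτ0 : (0 : ℝ) ≤ 1 + σ := by positivity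
  have hτ2 : 1 + σ ≤ 2 := by linarith only [hσ1]
  -- STEP 1 (n15-c∕215): the row of `G′(T)` at rate `δ − 2s`
  have hθK : CA * ((n : ℝ) * ρ * Real.exp δ) * c + |a| * (((n : ℝ) ^ (d + 1))⁻¹ * CG * (σ * (1 + σ) + σ)) ≤ K1 * r := by
    have h1 : CA * ((n : ℝ) * ρ * Real.exp δ) * c ≤ CA * (Cρ * r * Real.exp δ) * c :=
      mul_le_mul_of_nonneg_right (mul_le_mul_of_nonneg_left (mul_le_mul_of_nonneg_right hnρ (Real.exp_pos _).le) hCA) hc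
    have h3 : σ * (1 + σ) + σ ≤ 3 * (Cσ * r) := by
      have : σ * (1 + σ) ≤ σ * 2 := mul_le_mul_of_nonneg_left hτ2 hσ0
      linarith only [this, hσle]
    have h2 : |a| * (((n : ℝ) ^ (d + 1))⁻¹ * CG * (σ * (1 + σ) + σ)) ≤ α * (CG * (3 * (Cσ * r))) := by
      calc |a| * (((n : ℝ) ^ (d + 1))⁻¹ * CG * (σ * (1 + σ) + σ)) = (|a| * ((n : ℝ) ^ (d + 1))⁻¹) * (CG * (σ * (1 + σ) + σ)) := by ring
        _ ≤ α * (CG * (3 * (Cσ * r))) := mul_le_mul haα (mul_le_mul_of_nonneg_left h3 hCG) (by positivity) hα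
    calc _ ≤ CA * (Cρ * r * Real.exp δ) * c + α * (CG * (3 * (Cσ * r))) := add_le_add h1 h2
      _ = K1 * r := by rw [hK1def]; unfold cK1; ring
  have hθKc : (CA * ((n : ℝ) * ρ * Real.exp δ) * c + |a| * (((n : ℝ) ^ (d + 1))⁻¹ * CG * (σ * (1 + σ) + σ))) * c ≤ 1 / 2 :=
    (mul_le_mul_of_nonneg_right hθK hc).trans (by linarith only [hq1, show K1 * r * c = K1 * c * r by ring])
  have hqK : (CA * ((n : ℝ) * ρ * Real.exp δ) * c + |a| * (((n : ℝ) ^ (d + 1))⁻¹ * CG * (σ * (1 + σ) + σ))) * c < 1 := by linarith only [hθKc]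
  have hGT0 := hasMaj_cGreen_of_flat M n L k hT ha hs hr2s hrow hc hCG hCA hCD (by positivity : 0 ≤ P0 * r) hρ0 hσ0 hτ0 hρr hρc hσr hσc hτr hG1 hA1 hD1 hδD hqK
  have hAle : CG + CG * ((n : ℝ) * (((d + 1 : ℕ) : ℝ) * ρ) * Real.exp δ) * (CD + P0 * r) * c * c ≤ A0 := by
    have h1 : (n : ℝ) * (((d + 1 : ℕ) : ℝ) * ρ) ≤ ((d : ℝ) + 1) * Cρ := by
      calc (n : ℝ) * (((d + 1 : ℕ) : ℝ) * ρ) = ((d : ℝ) + 1) * ((n : ℝ) * ρ) := by push_cast; ring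
        _ ≤ ((d : ℝ) + 1) * (Cρ * r) := mul_le_mul_of_nonneg_left hnρ hD
        _ ≤ ((d : ℝ) + 1) * Cρ := mul_le_mul_of_nonneg_left (mul_le_of_le_one_right hCρ hr1) hD
    have h2 : CD + P0 * r ≤ CD + P0 := add_le_add le_rfl (mul_le_of_le_one_right hP0 hr1)
    have t1 : (n : ℝ) * (((d + 1 : ℕ) : ℝ) * ρ) * Real.exp δ ≤ ((d : ℝ) + 1) * Cρ * Real.exp δ := mul_le_mul_of_nonneg_right h1 (Real.exp_pos _).le
    have t2 : CG * ((n : ℝ) * (((d + 1 : ℕ) : ℝ) * ρ) * Real.exp δ) * (CD + P0 * r) ≤ CG * (((d : ℝ) + 1) * Cρ * Real.exp δ) * (CD + P0) :=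
      mul_le_mul (mul_le_mul_of_nonneg_left t1 hCG) h2 (by positivity) (by positivity)
    have t3 := mul_le_mul_of_nonneg_right (mul_le_mul_of_nonneg_right t2 hc) hc
    calc _ ≤ CG + CG * (((d : ℝ) + 1) * Cρ * Real.exp δ) * (CD + P0) * c * c := add_le_add le_rfl t3
      _ = A0 := by rw [hA0def]; unfold cA0; ring
  have hinvK : (1 - (CA * ((n : ℝ) * ρ * Real.exp δ) * c + |a| * (((n : ℝ) ^ (d + 1))⁻¹ * CG * (σ * (1 + σ) + σ))) * c)⁻¹ ≤ 2 := by
    calc _ ≤ (1 / 2 : ℝ)⁻¹ := inv_anti₀ (by norm_num) (by linarith only [hθKc])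
      _ = 2 := by norm_num
  have hGT : HasMaj (BlockNorm.ofBlocks (unitTorusGeo L k M) (liftBlk (blockOf n M) ι)) (BlockNorm.ofBlocks (unitTorusGeo L k M) (liftBlk (blockOf n M) ι)) (Matrix.mulVecLin (cGreen M n T a)) (fun y y' => (2 * A0) * Real.exp (-((δ - 2 * s) * tdistT M y y'))) := by
    refine hGT0.mono fun y y' => mul_le_mul_of_nonneg_right ?_ (Real.exp_nonneg _)
    calc _ ≤ A0 * 2 := mul_le_mul hAle hinvK (inv_nonneg.mpr (by linarith only [hθKc])) hA0
      _ = 2 * A0 := mul_comm _ _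
  -- STEP 2 (n15-c∕216 §1): the row of `G′(T) − G′(1)` at rate `δ − 2s`
  have hδG0 := hasMaj_cGreen_sub_of_flat M n L k hT ha (δT := δ - 2 * s) hs hr6 hr5 hrow hc hCG hCA hCD (by positivity : 0 ≤ P0 * r)
    (by positivity : 0 ≤ 2 * A0) hρ0 hσ0 hτ0 hρr hρc hσr hσc hτr hG1 hA1 hD1 hδD hGT
  obtain ⟨PG, hPGdef⟩ : ∃ x : ℝ, x = CG * ((n : ℝ) * (((d + 1 : ℕ) : ℝ) * ρ) * Real.exp δ) * c * (CD + P0 * r) * c + CA * ((n : ℝ) * ρ * Real.exp (δ - 2 * s + s) * (2 * A0) * c) * c +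
      |a| * (CG * (((n : ℝ) ^ (d + 1))⁻¹ * σ * ((1 + σ) * (2 * A0))) * c) + |a| * (CG * (((n : ℝ) ^ (d + 1))⁻¹ * 1 * (σ * (2 * A0))) * c) := ⟨_, rfl⟩
  have hPG : 0 ≤ PG := by rw [hPGdef]; positivity
  have hδG : HasMaj (BlockNorm.ofBlocks (unitTorusGeo L k M) (liftBlk (blockOf n M) ι)) (BlockNorm.ofBlocks (unitTorusGeo L k M) (liftBlk (blockOf n M) ι)) (Matrix.mulVecLin (cGreen M n T a - cGreen M n (fun (_ : Fin (d + 1)) (_ : Tor (fine n M)) => (1 : Matrix ι ι ℝ)) a)) (fun y y' => PG * Real.exp (-((δ - 2 * s) * tdistT M y y'))) := by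
    rw [hPGdef]; exact hδG0
  have hPGle : PG ≤ PG0 * r := by
    have hex : Real.exp (δ - 2 * s + s) ≤ Real.exp δ := Real.exp_le_exp.mpr hr7
    have h11 : (n : ℝ) * (((d + 1 : ℕ) : ℝ) * ρ) ≤ ((d : ℝ) + 1) * (Cρ * r) := by
      calc (n : ℝ) * (((d + 1 : ℕ) : ℝ) * ρ) = ((d : ℝ) + 1) * ((n : ℝ) * ρ) := by push_cast; ring
        _ ≤ ((d : ℝ) + 1) * (Cρ * r) := mul_le_mul_of_nonneg_left hnρ hD
    have h12 : CD + P0 * r ≤ CD + P0 := add_le_add le_rfl (mul_le_of_le_one_right hP0 hr1)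
    have t1 : CG * ((n : ℝ) * (((d + 1 : ℕ) : ℝ) * ρ) * Real.exp δ) * c ≤ CG * (((d : ℝ) + 1) * (Cρ * r) * Real.exp δ) * c :=
      mul_le_mul_of_nonneg_right (mul_le_mul_of_nonneg_left (mul_le_mul_of_nonneg_right h11 (Real.exp_pos _).le) hCG) hc
    have h1 : CG * ((n : ℝ) * (((d + 1 : ℕ) : ℝ) * ρ) * Real.exp δ) * c * (CD + P0 * r) * c ≤ CG * (((d : ℝ) + 1) * (Cρ * r) * Real.exp δ) * c * (CD + P0) * c :=
      mul_le_mul_of_nonneg_right (mul_le_mul t1 h12 (by positivity) (by positivity)) hc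
    have t2 : (n : ℝ) * ρ * Real.exp (δ - 2 * s + s) ≤ Cρ * r * Real.exp δ := mul_le_mul hnρ hex (Real.exp_pos _).le (by positivity)
    have h2 : CA * ((n : ℝ) * ρ * Real.exp (δ - 2 * s + s) * (2 * A0) * c) * c ≤ CA * (Cρ * r * Real.exp δ * (2 * A0) * c) * c :=
      mul_le_mul_of_nonneg_right (mul_le_mul_of_nonneg_left (mul_le_mul_of_nonneg_right (mul_le_mul_of_nonneg_right t2 (by positivity)) hc) hCA) hc
    have h30 : σ * ((1 + σ) * (2 * A0)) ≤ Cσ * r * (2 * (2 * A0)) := by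
      calc σ * ((1 + σ) * (2 * A0)) ≤ (Cσ * r) * (2 * (2 * A0)) := mul_le_mul hσle (mul_le_mul_of_nonneg_right hτ2 (by positivity)) (by positivity) (by positivity)
        _ = Cσ * r * (2 * (2 * A0)) := by ring
    have h3 : |a| * (CG * (((n : ℝ) ^ (d + 1))⁻¹ * σ * ((1 + σ) * (2 * A0))) * c) ≤ α * (CG * (Cσ * r * (2 * (2 * A0))) * c) := by
      calc |a| * (CG * (((n : ℝ) ^ (d + 1))⁻¹ * σ * ((1 + σ) * (2 * A0))) * c) = (|a| * ((n : ℝ) ^ (d + 1))⁻¹) * (CG * (σ * ((1 + σ) * (2 * A0))) * c) := by ring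
        _ ≤ α * (CG * (Cσ * r * (2 * (2 * A0))) * c) :=
            mul_le_mul haα (mul_le_mul_of_nonneg_right (mul_le_mul_of_nonneg_left h30 hCG) hc) (by positivity) hα
    have h40 : σ * (2 * A0) ≤ Cσ * r * (2 * A0) := mul_le_mul_of_nonneg_right hσle (by positivity)
    have h4 : |a| * (CG * (((n : ℝ) ^ (d + 1))⁻¹ * 1 * (σ * (2 * A0))) * c) ≤ α * (CG * (Cσ * r * (2 * A0)) * c) := by
      calc |a| * (CG * (((n : ℝ) ^ (d + 1))⁻¹ * 1 * (σ * (2 * A0))) * c) = (|a| * ((n : ℝ) ^ (d + 1))⁻¹) * (CG * (σ * (2 * A0)) * c) := by ring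
        _ ≤ α * (CG * (Cσ * r * (2 * A0)) * c) := mul_le_mul haα (mul_le_mul_of_nonneg_right (mul_le_mul_of_nonneg_left h40 hCG) hc) (by positivity) hα
    calc PG = _ := hPGdef
      _ ≤ CG * (((d : ℝ) + 1) * (Cρ * r) * Real.exp δ) * c * (CD + P0) * c + CA * (Cρ * r * Real.exp δ * (2 * A0) * c) * c +
          α * (CG * (Cσ * r * (2 * (2 * A0))) * c) + α * (CG * (Cσ * r * (2 * A0)) * c) := add_le_add (add_le_add (add_le_add h1 h2) h3) h4
      _ = PG0 * r := by rw [hPG0def]; unfold cPG0; rw [← hA0def]; ring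
  -- STEP 3: the common rate `δ′ = δ − 2s`, the common constants `C_M`, and the minimizer rows
  have hCGle : CG ≤ CM := by rw [hCM]; linarith only [hA0]
  have h2A0le : 2 * A0 ≤ CM := by rw [hCM]; linarith only [hCG]
  have hG1' : HasMaj (BlockNorm.ofBlocks (unitTorusGeo L k M) (liftBlk (blockOf n M) ι)) (BlockNorm.ofBlocks (unitTorusGeo L k M) (liftBlk (blockOf n M) ι)) (Matrix.mulVecLin (cGreen M n (fun (_ : Fin (d + 1)) (_ : Tor (fine n M)) => (1 : Matrix ι ι ℝ)) a)) (fun y y' => CM * Real.exp (-((δ - 2 * s) * tdistT M y y'))) :=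
    (hG1.of_rate_le hd hCG hr4).mono fun y y' => mul_le_mul_of_nonneg_right hCGle (Real.exp_nonneg _)
  have hGT' : HasMaj (BlockNorm.ofBlocks (unitTorusGeo L k M) (liftBlk (blockOf n M) ι)) (BlockNorm.ofBlocks (unitTorusGeo L k M) (liftBlk (blockOf n M) ι)) (Matrix.mulVecLin (cGreen M n T a)) (fun y y' => CM * Real.exp (-((δ - 2 * s) * tdistT M y y'))) :=
    hGT.mono fun y y' => mul_le_mul_of_nonneg_right h2A0le (Real.exp_nonneg _)
  have hMT := hasMaj_cM_of M n L k hCM0 hτ0 hτc hGT'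
  have hM1 := hasMaj_cM_of M n L k (T := (fun (_ : Fin (d + 1)) (_ : Tor (fine n M)) => (1 : Matrix ι ι ℝ))) hCM0 zero_le_one (stair_one_cols M n) hG1'
  have hδM := hasMaj_cM_sub_of M n L k hCM0 hPG hτ0 hσ0 hτc hσc hG1' hδG
  -- STEP 4 (n15-c∕214 + 216 §2): `S(T) − S(1)` and `S(T)⁻¹`
  have hδS := hasMaj_cSop_sub_of M n L k hCM0 hPG hτ0 hσ0 hs hr3 hrow hMT hM1 hδM
  have hBle : Fintype.card ι * c * CM * ((1 + σ) + 1) * (PG * (1 + σ) + CM * σ) ≤ B0 * r := by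
    have h1 : (1 + σ) + 1 ≤ 3 := by linarith only [hσ1]
    have h21 : PG * (1 + σ) ≤ PG0 * r * 2 := mul_le_mul hPGle hτ2 hτ0 (by positivity)
    have h22 : CM * σ ≤ CM * (Cσ * r) := mul_le_mul_of_nonneg_left hσle hCM0
    have h2 : PG * (1 + σ) + CM * σ ≤ (2 * PG0 + CM * Cσ) * r := by linarith only [h21, h22, show PG0 * r * 2 + CM * (Cσ * r) = (2 * PG0 + CM * Cσ) * r by ring]
    calc _ ≤ Fintype.card ι * c * CM * 3 * ((2 * PG0 + CM * Cσ) * r) := mul_le_mul (mul_le_mul_of_nonneg_left h1 (by positivity)) h2 (by positivity) (by positivity)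
      _ = B0 * r := by rw [hB0eq]; ring
  have hqS' : CS * (Fintype.card ι * c * CM * ((1 + σ) + 1) * (PG * (1 + σ) + CM * σ)) * c * c ≤ 1 / 2 := by
    have : CS * (Fintype.card ι * c * CM * ((1 + σ) + 1) * (PG * (1 + σ) + CM * σ)) * c * c ≤ CS * (B0 * r) * c * c :=
      mul_le_mul_of_nonneg_right (mul_le_mul_of_nonneg_right (mul_le_mul_of_nonneg_left hBle hCS) hc) hc
    exact this.trans (by linarith only [hq2, show CS * (B0 * r) * c * c = CS * B0 * c * c * r by ring])
  have hqS : CS * (Fintype.card ι * c * CM * ((1 + σ) + 1) * (PG * (1 + σ) + CM * σ)) * c * c < 1 := by linarith only [hqS']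
  have hS1' := hS1.of_rate_le hd (by positivity) hr4
  have hST0 := hasMaj_cSop_inv_of_flat M n L k hT ha (δ₁ := δ - 2 * s) hs hr13 hrow hc hCS (by positivity) hS1' hδS hqS
  have hinvS : (1 - CS * (Fintype.card ι * c * CM * ((1 + σ) + 1) * (PG * (1 + σ) + CM * σ)) * c * c)⁻¹ ≤ 2 := by
    calc _ ≤ (1 / 2 : ℝ)⁻¹ := inv_anti₀ (by norm_num) (by linarith only [hqS'])
      _ = 2 := by norm_num
  -- STEP 5 (n15-c∕214): everything at `δ″ = 3δ/4 ≤ δ − 4s`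
  have hST : HasMaj (BlockNorm.ofBlocks (unitTorusGeo L k M) (liftBlk (fun y : Tor M => y) ι)) (BlockNorm.ofBlocks (unitTorusGeo L k M) (liftBlk (fun y : Tor M => y) ι)) (Matrix.mulVecLin (cSop M n T a)⁻¹) (fun y y' => (2 * CS) * (n : ℝ) ^ (d + 1) * Real.exp (-((3 * δ / 4) * tdistT M y y'))) := by
    refine (hST0.mono fun y y' => mul_le_mul_of_nonneg_right ?_ (Real.exp_nonneg _)).of_rate_le hd (by positivity) hr8
    calc CS * (n : ℝ) ^ (d + 1) * (1 - CS * (Fintype.card ι * c * CM * ((1 + σ) + 1) * (PG * (1 + σ) + CM * σ)) * c * c)⁻¹ ≤ CS * (n : ℝ) ^ (d + 1) * 2 :=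
          mul_le_mul_of_nonneg_left hinvS (by positivity)
      _ = (2 * CS) * (n : ℝ) ^ (d + 1) := by ring
  have hCS2 : CS * (n : ℝ) ^ (d + 1) ≤ (2 * CS) * (n : ℝ) ^ (d + 1) := mul_le_mul_of_nonneg_right (by linarith only [hCS]) hn.le
  have hS1'' : HasMaj (BlockNorm.ofBlocks (unitTorusGeo L k M) (liftBlk (fun y : Tor M => y) ι)) (BlockNorm.ofBlocks (unitTorusGeo L k M) (liftBlk (fun y : Tor M => y) ι)) (Matrix.mulVecLin (cSop M n (fun (_ : Fin (d + 1)) (_ : Tor (fine n M)) => (1 : Matrix ι ι ℝ)) a)⁻¹) (fun y y' => (2 * CS) * (n : ℝ) ^ (d + 1) * Real.exp (-((3 * δ / 4) * tdistT M y y'))) :=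
    (hS1.of_rate_le hd (by positivity) hr9).mono fun y y' => mul_le_mul_of_nonneg_right hCS2 (Real.exp_nonneg _)
  have hG1'' := hG1'.of_rate_le hd hCM0 hr10
  have hGT'' := hGT'.of_rate_le hd hCM0 hr10
  have hD1'' := hD1.of_rate_le hd hCD hr9
  have hδD'' := hδD.of_rate_le hd (by positivity) hr9
  have hδG'' := hδG.of_rate_le hd hPG hr10
  have key := hasMaj_landauCov_sub M n L k hT ha (δ := 3 * δ / 4) hr12 hCM0 (by positivity : 0 ≤ 2 * CS) hCD (by positivity : 0 ≤ P0 * r) hPG hτ0 hσ0 hτc hσc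
    hG1'' hGT'' hD1'' hδD'' hδG'' hST hS1''
  -- STEP 6: the constant is `≤ landauRowConst · r`, the rate `(3δ/4)/2 = 3δ/8`
  have hcs' : 0 ≤ B4Sect5Proof.latticeConst (d + 1) (3 * δ / 4 / 8) := B4Sect5Proof.latticeConst_nonneg (d + 1) (by positivity)
  have key' := key.of_rate_le hd (landauLetterConst_nonneg (by positivity) (by positivity) hcs' (by positivity) hCM0 hCD (by positivity) hPG hτ0 hσ0) hr11
  refine key'.mono fun y y' => mul_le_mul_of_nonneg_right ?_ (Real.exp_nonneg _)
  calc landauLetterConst (d + 1) (Fintype.card ι) (B4Sect5Proof.latticeConst (d + 1) (3 * δ / 4 / 8)) (2 * CS) CM CD (P0 * r) PG (1 + σ) σ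
      ≤ landauLetterConst (d + 1) (Fintype.card ι) (B4Sect5Proof.latticeConst (d + 1) (3 * δ / 4 / 8)) (2 * CS) CM CD (P0 * r) (PG0 * r) 2 (Cσ * r) :=
        landauLetterConst_mono (by positivity) (by positivity) hcs' (by positivity) hCM0 hCD (by positivity) hPG hτ0 hσ0 le_rfl hPGle hτ2 hσle
    _ ≤ r * landauLetterConst (d + 1) (Fintype.card ι) (B4Sect5Proof.latticeConst (d + 1) (3 * δ / 4 / 8)) (2 * CS) CM CD P0 PG0 2 Cσ :=
        landauLetterConst_linear (by positivity) (by positivity) hcs' (by positivity) hCM0 hCD hP0 hPG0 (by norm_num) hCσ hr0 hr1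
    _ = _ := by rw [hCMdef, hPG0def]; unfold landauRowConst; ring

end Main

end Summit.QuantumFields.YangMills.BalabanUVNodes.N15.CovLandau

end
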